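import Summits.AnomalousDissipation.AnomalousDissipation.Theorems.NeutralTaylorWavesTaylorWaveQuasiSteadyHierarchyEnergyTools
import Literature.Analysis.FunctionSpaces.TorusEnstrophyOrthogonality
import Literature.Analysis.FunctionSpaces.TorusClassicalNSUniqueness

/-!
# Leading energy identity of the ε-free hierarchy — the integrals (line `windfibred`, rev 3)
# (crux stmt-AnomalousDissipation-16293, `NeutralTaylorWaves.TaylorWaveQuasiSteady`)

Pairing the order-one equation `M_1 = hierarchyCoeff … 1 = 0` of the open core `stub_hierarchyW` with the leading
profile `P_0` and integrating over `T⁴` produces seven integrals; this file evaluates the three that carry the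
structure of the two-scale steady Navier–Stokes operator:

* `integral_transport_eq_zero` — TWO-SCALE TRANSPORT IS ENERGY-NEUTRAL: with `d_1 = div_x P_0 + k·∂_θ P_1 = 0`,
  `∫ ⟪(P_0·∇_x)P_0, P_0⟫ + ∫ ⟪(P_1·k)∂_θ P_0, P_0⟫ = 0` (both are `½ × (two-scale divergence) × ‖P_0‖²` after
  integration by parts);
* `integral_eikonal_transport_eq_zero` — with `d_0 = 0` and the eikonal/polarisation identity
  `((P_0·k) − c_0k_2) ∂_θ P_0 = 0` (`Eikonal.eikonal_of_order_zero`), the `P_0·k`-transport and the `c_0`-drift of `P_1`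
  do no work on `P_0`: `∫ ⟪((P_0·k) − c_0 k_2) ∂_θ P_1, P_0⟫ = 0`;
* `integral_viscous_eq_dissDensity` — the fast viscous term integrates by parts to the Taylor-scale dissipation,
  `−∫ ⟪∑ᵢ kᵢ∂_θ(kᵢ∂_θP_0), P_0⟫ = ∫ |k|²‖∂_θP_0‖² = ∫ dissDensity`.

Tools: `Energy.integral_mul_inner_partialDeriv_eq` etc. (`…HierarchyEnergyTools.lean`, p165512), the landed
`FormalExpansion.isSmooth_sDeriv/_fDeriv`.  Registered as the tools sub-stub `stub_hierarchyWEnergyLemmas` (last theorem).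
The identity itself is assembled in `…HierarchyEnergy.lean`. [folklore]
-/

-- `Summit.<Summit>.<Problem>` is the tree's mandated summit-side namespace (CONVENTIONS §2); for this
-- single-conjunct summit the two coincide, so the duplicate is deliberate.
set_option linter.dupNamespace false

noncomputable section

open scoped BigOperators InnerProductSpace ContDiff
open MeasureTheory
open Literature.Analysis.FunctionSpaces Literature.Analysis.FunctionSpaces.Torus

namespace Summit.AnomalousDissipation.AnomalousDissipation.Theorems.TaylorWaveQuasiSteady.Energy

open Summit.AnomalousDissipation.AnomalousDissipation.Theorems.TaylorWaveQuasiSteady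

variable {F : Type*} [NormedAddCommGroup F] [NormedSpace ℝ F]

/-! ## Energy §1 Pointwise rewrites -/

section Body

variable {j : Fin 3 → ℤ} {G : UnitAddTorus (Fin 3) → ℝ} {f : UnitAddTorus (Fin 3) → EuclideanSpace ℝ (Fin 3)} {N : ℕ}
  {P : ℕ → UnitAddTorus (Fin 4) → EuclideanSpace ℝ (Fin 3)} {Q : ℕ → UnitAddTorus (Fin 4) → ℝ} {c : ℕ → ℝ}

/-- The real inner product on `ℝ³` in coordinates. [folklore] -/
theorem inner_eq_sum_mul (u v : EuclideanSpace ℝ (Fin 3)) : ⟪u, v⟫_ℝ = ∑ i : Fin 3, u i * v i := by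
  simp [EuclideanSpace.inner_eq_star_dotProduct, dotProduct, mul_comm]

/-- `⟪∑ₗ aₗ • Xₗ, v⟫ = ∑ₗ aₗ ⟪Xₗ, v⟫`. [folklore] -/
theorem inner_sum_smul_left (a : Fin 3 → ℝ) (X : Fin 3 → EuclideanSpace ℝ (Fin 3)) (v : EuclideanSpace ℝ (Fin 3)) :
    ⟪∑ l : Fin 3, a l • X l, v⟫_ℝ = ∑ l : Fin 3, a l * ⟪X l, v⟫_ℝ := by
  rw [sum_inner]
  exact Finset.sum_congr rfl fun l _ => real_inner_smul_left _ _ _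

/-- The phase gradient read on `T⁴` is a smooth profile. [folklore] -/
theorem isSmooth_phaseGrad_slow (j : Fin 3 → ℤ) (hG : IsSmooth G) (i : Fin 3) :
    IsSmooth (fun y : UnitAddTorus (Fin 4) => phaseGrad j G i (slow y)) :=
  ResidualTransfer.isSmooth_comp_slow (DissipationLaw.isSmooth_phaseGrad j hG i)

/-- Coordinates of smooth profiles are smooth. [folklore] -/
theorem isSmooth_coord {U : UnitAddTorus (Fin 4) → EuclideanSpace ℝ (Fin 3)} (hU : IsSmooth U) (l : Fin 3) :
    IsSmooth (fun y => U y l) :=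
  hU.comp_clm (EuclideanSpace.proj l)

/-- Finite sums of smooth profiles are smooth. [folklore] -/
theorem isSmooth_fsum {ι : Type*} (s : Finset ι) {g : ι → UnitAddTorus (Fin 4) → F} (hg : ∀ i ∈ s, IsSmooth (g i)) :
    IsSmooth (fun y => ∑ i ∈ s, g i y) := by
  have hl : Torus.lift (fun y => ∑ i ∈ s, g i y) = fun z => ∑ i ∈ s, Torus.lift (g i) z := rfl
  unfold IsSmooth
  rw [hl]
  exact ContDiff.sum fun i hi => hg i hi

/-- `∂_θ (kᵢ Φ) = kᵢ ∂_θ Φ` for a smooth real profile `Φ` (the phase gradient has no fast dependence). [folklore] -/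
theorem partialDeriv_last_phaseGrad_mul (j : Fin 3 → ℤ) (hG : IsSmooth G) (i : Fin 3)
    {Φ : UnitAddTorus (Fin 4) → ℝ} (hΦ : IsSmooth Φ) (y : UnitAddTorus (Fin 4)) :
    partialDeriv (Fin.last 3) (fun z => phaseGrad j G i (slow z) * Φ z) y =
      phaseGrad j G i (slow y) * partialDeriv (Fin.last 3) Φ y := by
  rw [partialDeriv_mul ((isSmooth_phaseGrad_slow j hG i).isContDiff (by simp)) (hΦ.isContDiff (by simp)),
    partialDeriv_last_comp_slow (fun x => phaseGrad j G i x) y, zero_mul, add_zero]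

/-! ## Energy §2 The five integrals -/

/-- **Two-scale transport is energy-neutral**: with `d_1 = 0` (`div_x P_0 + k·∂_θP_1 = 0`),
`∫ ⟪(P_0·∇_x)P_0, P_0⟫ + ∫ ⟪(P_1·k)∂_θ P_0, P_0⟫ = 0`. [folklore] -/
theorem integral_transport_eq_zero (hG : IsSmooth G) (hP : ∀ a, IsSmooth (P a))
    (hd1 : ∀ y, (∑ i : Fin 3, (sDeriv i (P 0) y) i) + ∑ i : Fin 3, (fDeriv j G i (P 1) y) i = 0) :
    (∫ y, ⟪∑ l : Fin 3, (P 0 y) l • sDeriv l (P 0) y, P 0 y⟫_ℝ)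
      + ∫ y, ⟪∑ l : Fin 3, (P 1 y) l • fDeriv j G l (P 0) y, P 0 y⟫_ℝ = 0 := by
  have hP0 := hP 0
  have hP1 := hP 1
  have hP01 : IsContDiff 1 (P 0) := hP0.isContDiff (by simp)
  have hP11 : IsContDiff 1 (P 1) := hP1.isContDiff (by simp)
  -- the slow part, coordinate by coordinate
  have hslow : ∀ l : Fin 3, 2 * ∫ y, (P 0 y) l * ⟪sDeriv l (P 0) y, P 0 y⟫_ℝ =
      -∫ y, (sDeriv l (P 0) y) l * ⟪P 0 y, P 0 y⟫_ℝ := by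
    intro l
    have h := integral_mul_inner_partialDeriv_eq (isSmooth_coord hP0 l) hP0 hP0 l.castSucc
    have hsym : (fun y => (P 0 y) l * ⟪P 0 y, partialDeriv l.castSucc (P 0) y⟫_ℝ) =
        fun y => (P 0 y) l * ⟪partialDeriv l.castSucc (P 0) y, P 0 y⟫_ℝ :=
      funext fun y => by rw [real_inner_comm]
    have hcoord : (fun y => partialDeriv l.castSucc (fun y => (P 0 y) l) y * ⟪P 0 y, P 0 y⟫_ℝ) =
        fun y => (sDeriv l (P 0) y) l * ⟪P 0 y, P 0 y⟫_ℝ :=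
      funext fun y => by rw [partialDeriv_apply_coord' hP01]; rfl
    rw [hsym, hcoord] at h
    simp only [sDeriv] at h ⊢
    linarith
  -- the fast part
  set π : UnitAddTorus (Fin 4) → ℝ := fun y => ∑ l : Fin 3, (P 1 y) l * phaseGrad j G l (slow y) with hπ
  have hπs : IsSmooth π :=
    isSmooth_fsum Finset.univ fun l _ => isSmooth_mul (isSmooth_coord hP1 l) (isSmooth_phaseGrad_slow j hG l)
  have hπd : ∀ y, partialDeriv (Fin.last 3) π y = ∑ i : Fin 3, (fDeriv j G i (P 1) y) i := by
    intro y
    have h1 : partialDeriv (Fin.last 3) π y =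
        ∑ l : Fin 3, partialDeriv (Fin.last 3) (fun y => (P 1 y) l * phaseGrad j G l (slow y)) y := by
      rw [hπ]
      exact partialDeriv_finset_sum Finset.univ
        (fun l _ => (isSmooth_mul (isSmooth_coord hP1 l) (isSmooth_phaseGrad_slow j hG l)).isContDiff (by simp))
        (Fin.last 3) y
    rw [h1]
    refine Finset.sum_congr rfl fun l _ => ?_
    have h2 : (fun y => (P 1 y) l * phaseGrad j G l (slow y)) = fun y => phaseGrad j G l (slow y) * (P 1 y) l := by
      funext y; ring
    rw [h2, partialDeriv_last_phaseGrad_mul j hG l (isSmooth_coord hP1 l), partialDeriv_apply_coord' hP11]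
    simp only [fDeriv, PiLp.smul_apply, smul_eq_mul]
  have hfast_pt : ∀ y, ⟪∑ l : Fin 3, (P 1 y) l • fDeriv j G l (P 0) y, P 0 y⟫_ℝ =
      π y * ⟪partialDeriv (Fin.last 3) (P 0) y, P 0 y⟫_ℝ := by
    intro y
    simp only [fDeriv, smul_smul, hπ]
    rw [← Finset.sum_smul, real_inner_smul_left]
  have hfast : 2 * ∫ y, π y * ⟪partialDeriv (Fin.last 3) (P 0) y, P 0 y⟫_ℝ =
      -∫ y, (∑ i : Fin 3, (fDeriv j G i (P 1) y) i) * ⟪P 0 y, P 0 y⟫_ℝ := by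
    have h := integral_mul_inner_partialDeriv_eq hπs hP0 hP0 (Fin.last 3)
    have hsym : (fun y => π y * ⟪P 0 y, partialDeriv (Fin.last 3) (P 0) y⟫_ℝ) =
        fun y => π y * ⟪partialDeriv (Fin.last 3) (P 0) y, P 0 y⟫_ℝ :=
      funext fun y => by rw [real_inner_comm]
    have hder : (fun y => partialDeriv (Fin.last 3) π y * ⟪P 0 y, P 0 y⟫_ℝ) =
        fun y => (∑ i : Fin 3, (fDeriv j G i (P 1) y) i) * ⟪P 0 y, P 0 y⟫_ℝ :=
      funext fun y => by rw [hπd]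
    rw [hsym, hder] at h
    linarith
  -- combine with `d_1 = 0`
  have hslow' : 2 * ∫ y, ⟪∑ l : Fin 3, (P 0 y) l • sDeriv l (P 0) y, P 0 y⟫_ℝ =
      -∫ y, (∑ l : Fin 3, (sDeriv l (P 0) y) l) * ⟪P 0 y, P 0 y⟫_ℝ := by
    have hpt : ∀ y, ⟪∑ l : Fin 3, (P 0 y) l • sDeriv l (P 0) y, P 0 y⟫_ℝ =
        ∑ l : Fin 3, (P 0 y) l * ⟪sDeriv l (P 0) y, P 0 y⟫_ℝ := fun y => inner_sum_smul_left _ _ _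
    simp_rw [hpt]
    rw [integral_finsetSum _ fun l _ =>
      (isSmooth_mul (isSmooth_coord hP0 l) ((FormalExpansion.isSmooth_sDeriv hP0 l).inner hP0)).integrable,
      Finset.mul_sum]
    have hrhs : ∫ y, (∑ l : Fin 3, (sDeriv l (P 0) y) l) * ⟪P 0 y, P 0 y⟫_ℝ =
        ∑ l : Fin 3, ∫ y, (sDeriv l (P 0) y) l * ⟪P 0 y, P 0 y⟫_ℝ := by
      simp_rw [Finset.sum_mul]
      exact integral_finsetSum _ fun l _ =>
        (isSmooth_mul (isSmooth_coord (FormalExpansion.isSmooth_sDeriv hP0 l) l) (hP0.inner hP0)).integrable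
    rw [hrhs, ← Finset.sum_neg_distrib]
    exact Finset.sum_congr rfl fun l _ => hslow l
  have hsum : 2 * ((∫ y, ⟪∑ l : Fin 3, (P 0 y) l • sDeriv l (P 0) y, P 0 y⟫_ℝ)
      + ∫ y, ⟪∑ l : Fin 3, (P 1 y) l • fDeriv j G l (P 0) y, P 0 y⟫_ℝ) =
      -∫ y, ((∑ l : Fin 3, (sDeriv l (P 0) y) l) + ∑ i : Fin 3, (fDeriv j G i (P 1) y) i) * ⟪P 0 y, P 0 y⟫_ℝ := by
    simp_rw [hfast_pt]
    rw [mul_add, hslow', hfast]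
    have i1 : Integrable (fun y => (∑ l : Fin 3, (sDeriv l (P 0) y) l) * ⟪P 0 y, P 0 y⟫_ℝ) :=
      (isSmooth_mul (isSmooth_fsum Finset.univ fun l _ => isSmooth_coord (FormalExpansion.isSmooth_sDeriv hP0 l) l)
        (hP0.inner hP0)).integrable
    have i2 : Integrable (fun y => (∑ i : Fin 3, (fDeriv j G i (P 1) y) i) * ⟪P 0 y, P 0 y⟫_ℝ) :=
      (isSmooth_mul (isSmooth_fsum Finset.univ fun i _ => isSmooth_coord (FormalExpansion.isSmooth_fDeriv j hG i hP1) i)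
        (hP0.inner hP0)).integrable
    have e : ∫ y, ((∑ l : Fin 3, (sDeriv l (P 0) y) l) + ∑ i : Fin 3, (fDeriv j G i (P 1) y) i) * ⟪P 0 y, P 0 y⟫_ℝ =
        (∫ y, (∑ l : Fin 3, (sDeriv l (P 0) y) l) * ⟪P 0 y, P 0 y⟫_ℝ)
          + ∫ y, (∑ i : Fin 3, (fDeriv j G i (P 1) y) i) * ⟪P 0 y, P 0 y⟫_ℝ := by
      simp_rw [add_mul]
      exact integral_add i1 i2
    rw [e]
    ring
  have hzero : ∫ y, ((∑ l : Fin 3, (sDeriv l (P 0) y) l) + ∑ i : Fin 3, (fDeriv j G i (P 1) y) i) * ⟪P 0 y, P 0 y⟫_ℝ = 0 := by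
    simp_rw [hd1, zero_mul, integral_zero]
  rw [hzero, neg_zero] at hsum
  linarith

/-- **The eikonal order kills the `P_0·k`-transport and the drift of `P_1`**: with `d_0 = 0` and
`((P_0·k) − c_0 k_2) ∂_θ P_0 = 0`, `∫ ⟪((P_0·k) − c_0 k_2) ∂_θ P_1, P_0⟫ = 0`. [folklore] -/
theorem integral_eikonal_transport_eq_zero (hG : IsSmooth G) (hP : ∀ a, IsSmooth (P a))
    (hd0 : ∀ y, ∑ i : Fin 3, (fDeriv j G i (P 0) y) i = 0)
    (heik : ∀ y, ((∑ l : Fin 3, (P 0 y) l * phaseGrad j G l (slow y)) - c 0 * phaseGrad j G 2 (slow y)) •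
      partialDeriv (Fin.last 3) (P 0) y = 0) :
    ∫ y, ⟪((∑ l : Fin 3, (P 0 y) l * phaseGrad j G l (slow y)) - c 0 * phaseGrad j G 2 (slow y)) •
        partialDeriv (Fin.last 3) (P 1) y, P 0 y⟫_ℝ = 0 := by
  have hP0 := hP 0
  have hP1 := hP 1
  have hP01 : IsContDiff 1 (P 0) := hP0.isContDiff (by simp)
  set g : UnitAddTorus (Fin 4) → ℝ :=
    fun y => (∑ l : Fin 3, (P 0 y) l * phaseGrad j G l (slow y)) - c 0 * phaseGrad j G 2 (slow y) with hg
  have hS1 : IsSmooth (fun y => ∑ l : Fin 3, (P 0 y) l * phaseGrad j G l (slow y)) :=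
    isSmooth_fsum Finset.univ fun l _ => isSmooth_mul (isSmooth_coord hP0 l) (isSmooth_phaseGrad_slow j hG l)
  have hS2 : IsSmooth (fun y : UnitAddTorus (Fin 4) => c 0 * phaseGrad j G 2 (slow y)) :=
    isSmooth_mul (isSmooth_const (c 0)) (isSmooth_phaseGrad_slow j hG 2)
  have hgs : IsSmooth g := hS1.sub hS2
  have hgd : ∀ y, partialDeriv (Fin.last 3) g y = 0 := by
    intro y
    have hs1 : IsContDiff 1 (fun y => ∑ l : Fin 3, (P 0 y) l * phaseGrad j G l (slow y)) := hS1.isContDiff (by simp)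
    have hs2 : IsContDiff 1 (fun y : UnitAddTorus (Fin 4) => c 0 * phaseGrad j G 2 (slow y)) :=
      hS2.isContDiff (by simp)
    have hg' : g = (fun y => ∑ l : Fin 3, (P 0 y) l * phaseGrad j G l (slow y)) -
        fun y : UnitAddTorus (Fin 4) => c 0 * phaseGrad j G 2 (slow y) := by
      funext y
      rfl
    have h1 : partialDeriv (Fin.last 3) g y =
        partialDeriv (Fin.last 3) (fun y => ∑ l : Fin 3, (P 0 y) l * phaseGrad j G l (slow y)) y
          - partialDeriv (Fin.last 3) (fun y : UnitAddTorus (Fin 4) => c 0 * phaseGrad j G 2 (slow y)) y := by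
      rw [hg', partialDeriv_sub hs1 hs2 (Fin.last 3), Pi.sub_apply]
    have h2 : partialDeriv (Fin.last 3) (fun y => ∑ l : Fin 3, (P 0 y) l * phaseGrad j G l (slow y)) y =
        ∑ i : Fin 3, (fDeriv j G i (P 0) y) i := by
      rw [partialDeriv_finset_sum Finset.univ
        (fun l _ => (isSmooth_mul (isSmooth_coord hP0 l) (isSmooth_phaseGrad_slow j hG l)).isContDiff (by simp))]
      refine Finset.sum_congr rfl fun l _ => ?_
      have h3 : (fun y => (P 0 y) l * phaseGrad j G l (slow y)) = fun y => phaseGrad j G l (slow y) * (P 0 y) l := by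
        funext y; ring
      rw [h3, partialDeriv_last_phaseGrad_mul j hG l (isSmooth_coord hP0 l), partialDeriv_apply_coord' hP01]
      simp only [fDeriv, PiLp.smul_apply, smul_eq_mul]
    have h4 : partialDeriv (Fin.last 3) (fun y : UnitAddTorus (Fin 4) => c 0 * phaseGrad j G 2 (slow y)) y = 0 :=
      partialDeriv_last_comp_slow (fun x => c 0 * phaseGrad j G 2 x) y
    rw [h1, h2, h4, hd0 y, sub_zero]
  have hpt : ∀ y, ⟪g y • partialDeriv (Fin.last 3) (P 1) y, P 0 y⟫_ℝ =
      g y * ⟪partialDeriv (Fin.last 3) (P 1) y, P 0 y⟫_ℝ := fun y => real_inner_smul_left _ _ _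
  show ∫ y, ⟪g y • partialDeriv (Fin.last 3) (P 1) y, P 0 y⟫_ℝ = 0
  simp_rw [hpt]
  rw [integral_mul_inner_partialDeriv_eq hgs hP1 hP0 (Fin.last 3)]
  have h5 : ∀ y, g y * ⟪P 1 y, partialDeriv (Fin.last 3) (P 0) y⟫_ℝ = 0 := by
    intro y
    rw [← real_inner_smul_right, heik y, inner_zero_right]
  simp_rw [h5, hgd, zero_mul, integral_zero]
  simp

/-- **The viscous term gives the dissipation**: `−∫ ⟪∑ᵢ kᵢ∂_θ(kᵢ∂_θ P_0), P_0⟫ = ∫ |k|²‖∂_θP_0‖²`. [folklore] -/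
theorem integral_viscous_eq_dissDensity (hG : IsSmooth G) (hP : ∀ a, IsSmooth (P a)) :
    -∫ y, ⟪∑ i : Fin 3, fDeriv j G i (fDeriv j G i (P 0)) y, P 0 y⟫_ℝ = ∫ y, dissDensity j G (P 0) y := by
  have hP0 := hP 0
  have hW : ∀ i, IsSmooth (fDeriv j G i (P 0)) := fun i => FormalExpansion.isSmooth_fDeriv j hG i hP0
  have hpt : ∀ y, ⟪∑ i : Fin 3, fDeriv j G i (fDeriv j G i (P 0)) y, P 0 y⟫_ℝ =
      ∑ i : Fin 3, phaseGrad j G i (slow y) * ⟪partialDeriv (Fin.last 3) (fDeriv j G i (P 0)) y, P 0 y⟫_ℝ := by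
    intro y
    simp only [fDeriv]
    exact inner_sum_smul_left _ _ _
  have hterm : ∀ i : Fin 3, ∫ y, phaseGrad j G i (slow y) * ⟪partialDeriv (Fin.last 3) (fDeriv j G i (P 0)) y, P 0 y⟫_ℝ =
      -∫ y, phaseGrad j G i (slow y) ^ 2 * ‖partialDeriv (Fin.last 3) (P 0) y‖ ^ 2 := by
    intro i
    rw [integral_mul_inner_partialDeriv_eq (isSmooth_phaseGrad_slow j hG i) (hW i) hP0 (Fin.last 3)]
    have h1 : ∀ y, phaseGrad j G i (slow y) * ⟪fDeriv j G i (P 0) y, partialDeriv (Fin.last 3) (P 0) y⟫_ℝ =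
        phaseGrad j G i (slow y) ^ 2 * ‖partialDeriv (Fin.last 3) (P 0) y‖ ^ 2 := by
      intro y
      rw [fDeriv, real_inner_smul_left, real_inner_self_eq_norm_sq]
      ring
    have h2 : ∀ y, partialDeriv (Fin.last 3) (fun z => phaseGrad j G i (slow z)) y *
        ⟪fDeriv j G i (P 0) y, P 0 y⟫_ℝ = 0 := by
      intro y
      rw [partialDeriv_last_comp_slow (fun x => phaseGrad j G i x) y, zero_mul]
    simp_rw [h1, h2, integral_zero, sub_zero]
  have i3 : ∀ i : Fin 3, Integrable (fun y => phaseGrad j G i (slow y) ^ 2 * ‖partialDeriv (Fin.last 3) (P 0) y‖ ^ 2) := by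
    intro i
    have hk2 : IsSmooth (fun y : UnitAddTorus (Fin 4) => phaseGrad j G i (slow y) ^ 2) :=
      (isSmooth_phaseGrad_slow j hG i).pow 2
    exact (isSmooth_mul hk2 (hP0.partialDeriv (Fin.last 3)).norm_sq).integrable
  simp_rw [hpt]
  rw [integral_finsetSum _ fun i _ =>
    (isSmooth_mul (isSmooth_phaseGrad_slow j hG i) (((hW i).partialDeriv (Fin.last 3)).inner hP0)).integrable]
  simp_rw [hterm]
  rw [Finset.sum_neg_distrib, neg_neg]
  unfold dissDensity
  rw [integral_finsetSum _ fun i _ => i3 i]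


end Body

/-! ## The registered tools sub-stub -/

/-- **stub_hierarchyWEnergyLemmas** (registered tools sub-stub of stmt-AnomalousDissipation-16293; conjunction of the
three integrals of this file). [folklore] -/
theorem stub_hierarchyWEnergyLemmas : (∀ {j : Fin 3 → ℤ} {G : UnitAddTorus (Fin 3) → ℝ} {P : ℕ → UnitAddTorus (Fin 4) → EuclideanSpace ℝ (Fin 3)}, Literature.Analysis.FunctionSpaces.Torus.IsSmooth G → (∀ a, Literature.Analysis.FunctionSpaces.Torus.IsSmooth (P a)) → (∀ y, (∑ i : Fin 3, (sDeriv i (P 0) y) i) + ∑ i : Fin 3, (fDeriv j G i (P 1) y) i = 0) → (∫ y, inner ℝ (∑ l : Fin 3, (P 0 y) l • sDeriv l (P 0) y) (P 0 y)) + ∫ y, inner ℝ (∑ l : Fin 3, (P 1 y) l • fDeriv j G l (P 0) y) (P 0 y) = 0) ∧ (∀ {j : Fin 3 → ℤ} {G : UnitAddTorus (Fin 3) → ℝ} {P : ℕ → UnitAddTorus (Fin 4) → EuclideanSpace ℝ (Fin 3)} {c : ℕ → ℝ}, Literature.Analysis.FunctionSpaces.Torus.IsSmooth G → (∀ a, Literature.Analysis.FunctionSpaces.Torus.IsSmooth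 (P a)) → (∀ y, ∑ i : Fin 3, (fDeriv j G i (P 0) y) i = 0) → (∀ y, ((∑ l : Fin 3, (P 0 y) l * phaseGrad j G l (slow y)) - c 0 * phaseGrad j G 2 (slow y)) • Literature.Analysis.FunctionSpaces.Torus.partialDeriv (Fin.last 3) (P 0) y = 0) → ∫ y, inner ℝ (((∑ l : Fin 3, (P 0 y) l * phaseGrad j G l (slow y)) - c 0 * phaseGrad j G 2 (slow y)) • Literature.Analysis.FunctionSpaces.Torus.partialDeriv (Fin.last 3) (P 1) y) (P 0 y) = 0) ∧ (∀ {j : Fin 3 → ℤ} {G : UnitAddTorus (Fin 3) → ℝ} {P : ℕ → UnitAddTorus (Fin 4) → EuclideanSpace ℝ (Fin 3)}, Literature.Analysis.FunctionSpaces.Torus.IsSmooth G → (∀ a, Literature.Analysis.FunctionSpaces.Torus.IsSmooth (P a)) → -∫ y, inner ℝ (∑ i : Fin 3, fDeriv j G i (fDeriv j G i (P 0)) y) (P 0 y) = ∫ y, dissDensity j G (P 0) y) :=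
  ⟨fun hG hP hd1 => integral_transport_eq_zero hG hP hd1,
    fun hG hP hd0 heik => integral_eikonal_transport_eq_zero hG hP hd0 heik,
    fun hG hP => integral_viscous_eq_dissDensity hG hP⟩

end Summit.AnomalousDissipation.AnomalousDissipation.Theorems.TaylorWaveQuasiSteady.Energy

end
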